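import Summits.Parity.GeneralizedHardyLittlewood.Theorems.PrimeLevelFamEdgeIdeaDeltasFloorDualQuarter
import HarnessLib

/-!
# Route `PrimeLevelFamEdge` — TYPED IDEA DELTAS, deck 18e: K-L21-3 — TAMENESS of the explicit AH¼ pair (PROVED: `quarterTame`,
# via `continuous_cosTransform`, `integrable_quarterRho`, `integrable_quarterNu` from the quadratic decay) and the ASSEMBLY
# `quarter_isDualWitnessQD` / `quarterWitnessExistsQD_of : QuarterParseval → QuarterWitnessExistsQD` /
# `heightWallLowerEdge_of_parseval : QuarterParseval → HeightWallLowerEdge` — the 0.7393 lower edge of K-L21-1's height wall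
# (all `B ≤ 3`, any minorant degree, window `< ½`) from the Poisson identity ALONE.  Seat ls-idea-lens-21 g2,
# `Sketch_L21_DualWitness.lean` v1.4 sha16 50f29e45c9970095 l.606–852 VERBATIM up to the namespace and the QD renaming
# (critic F b26.5 VERIFIED, axioms std for `heightWallLowerEdge_of_parseval` and `quarterTame`); typer ls-idea-typ-1 gen 3.
# HONESTY: nothing about ζ; `QuarterParseval` is a HYPOTHESIS; no exceptional-zero theorem (no Landau–Siegel / Siegel-zero
# exclusion, no Theorem 1–2 of arXiv:2211.02515, no repaired Margin232) is proved; typed ≠ proved.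
-/

namespace Summit.Parity.GeneralizedHardyLittlewood.Theorems.PrimeLevelFamEdgeIdeaDeltas.FloorDual

open Literature.NumberTheory.LFunctions MeasureTheory
open scoped Real

/-! #### Tameness of the explicit pair (PROVED from the decay fields) -/

/-- `c_k ≤ 1` for `k ≥ 2` (crude; the true supremum is `(1+b)/4 = 0.38`). -/
theorem quarterCoeff_le_one (k : ℕ) (hk : 2 ≤ k) : quarterCoeff k ≤ 1 := by
  have ht1 := quarterLevel_le_one
  have ht0 := seven_tenths_le_quarterLevel
  have hπ3 := Real.pi_gt_three
  have hπ0 : 0 < π := Real.pi_pos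
  have hk' : (2 : ℝ) ≤ k := by exact_mod_cast hk
  have hkpos : (0 : ℝ) < k := by linarith
  have hπk : 0 < π * k := mul_pos hπ0 hkpos
  have hπk2 : 0 < π ^ 2 * (k : ℝ) ^ 2 := by positivity
  have hBnn : 0 ≤ 8 / (π ^ 2 * (k : ℝ) ^ 2) := div_nonneg (by norm_num) hπk2.le
  have hCnn : 0 ≤ 16 / (π ^ 2 * (k : ℝ) ^ 2) := div_nonneg (by norm_num) hπk2.le
  have hπk6 : 6 ≤ π * k := by nlinarith
  have hdiv : 4 / (π * k) ≤ 4 / 6 := by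
    rw [div_le_div_iff₀ hπk (by norm_num)]
    nlinarith
  have hA : 4 / (π * k) * (1 - quarterLevel) ≤ 4 / 6 * (3 / 10) :=
    mul_le_mul hdiv (by linarith) (by linarith) (by norm_num)
  have hAnn : 0 ≤ 4 / (π * k) * (1 - quarterLevel) :=
    mul_nonneg (div_nonneg (by norm_num) hπk.le) (by linarith)
  unfold quarterCoeff quarterAtom
  split_ifs with h0 h2 h1
  · rw [div_le_one (by norm_num : (0:ℝ) < 4)]; linarith
  · rw [div_le_one (by norm_num : (0:ℝ) < 4)]; linarith
  · rw [div_le_one (by norm_num : (0:ℝ) < 4)]; linarith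
  · rw [div_le_one (by norm_num : (0:ℝ) < 4)]; linarith

/-- `r̂` is continuous for `r ∈ L¹` (dominated convergence). -/
theorem continuous_cosTransform {r : ℝ → ℝ} (hr : Integrable r) :
    Continuous (BGMM2023.cosTransform r) := by
  have h : BGMM2023.cosTransform r = fun α => ∫ u, r u * Real.cos (2 * π * α * u) := rfl
  rw [h]
  refine continuous_of_dominated (bound := fun u => ‖r u‖) ?_ ?_ hr.norm ?_
  · intro α
    exact hr.aestronglyMeasurable.mul (Continuous.aestronglyMeasurable (by fun_prop))
  · intro α
    filter_upwards with u
    rw [norm_mul]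
    refine mul_le_of_le_one_right (norm_nonneg _) ?_
    rw [Real.norm_eq_abs]; exact Real.abs_cos_le_one _
  · filter_upwards with u
    fun_prop

/-- A function with quadratic decay is integrable against `quarterRho` (lattice sum). -/
theorem integrable_quarterRho {r : ℝ → ℝ} (hr : Continuous r)
    (hdecay : ∃ C : ℝ, ∀ u : ℝ, |r u| ≤ C / (1 + u ^ 2)) : Integrable r quarterRho := by
  obtain ⟨C, hC⟩ := hdecay
  have hC0 : 0 ≤ C := by
    have := hC 0
    simp only [ne_eq, OfNat.ofNat_ne_zero, not_false_eq_true, zero_pow, add_zero, div_one] at this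
    exact le_trans (abs_nonneg _) this
  refine ⟨hr.aestronglyMeasurable, ?_⟩
  unfold HasFiniteIntegral quarterRho
  rw [lintegral_sum_measure]
  -- termwise evaluation
  have hterm : ∀ k : ℕ,
      ∫⁻ u, ‖r u‖ₑ ∂((ENNReal.ofReal (quarterCoeff (k + 2))) •
          (Measure.dirac ((k + 2 : ℝ) / 4) + Measure.dirac (-((k + 2 : ℝ) / 4))))
        = ENNReal.ofReal (quarterCoeff (k + 2)) *
            (‖r ((k + 2 : ℝ) / 4)‖ₑ + ‖r (-((k + 2 : ℝ) / 4))‖ₑ) := by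
    intro k
    rw [lintegral_smul_measure, lintegral_add_measure, lintegral_dirac, lintegral_dirac, smul_eq_mul]
  simp_rw [hterm]
  -- domination by a summable real sequence
  set g : ℕ → ℝ := fun k => 2 * C / (1 + ((k + 2 : ℝ) / 4) ^ 2) with hg
  have hg0 : ∀ k, 0 ≤ g k := fun k => by
    simp only [hg]; positivity
  have hbound : ∀ k : ℕ,
      ENNReal.ofReal (quarterCoeff (k + 2)) *
          (‖r ((k + 2 : ℝ) / 4)‖ₑ + ‖r (-((k + 2 : ℝ) / 4))‖ₑ)
        ≤ ENNReal.ofReal (g k) := by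
    intro k
    have hc1 : ENNReal.ofReal (quarterCoeff (k + 2)) ≤ 1 := by
      rw [← ENNReal.ofReal_one]
      exact ENNReal.ofReal_le_ofReal (quarterCoeff_le_one (k + 2) (by omega))
    have h1 : ‖r ((k + 2 : ℝ) / 4)‖ₑ ≤ ENNReal.ofReal (C / (1 + ((k + 2 : ℝ) / 4) ^ 2)) := by
      rw [Real.enorm_eq_ofReal_abs]
      exact ENNReal.ofReal_le_ofReal (hC _)
    have h2 : ‖r (-((k + 2 : ℝ) / 4))‖ₑ ≤ ENNReal.ofReal (C / (1 + ((k + 2 : ℝ) / 4) ^ 2)) := by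
      rw [Real.enorm_eq_ofReal_abs]
      refine ENNReal.ofReal_le_ofReal ?_
      have := hC (-((k + 2 : ℝ) / 4))
      rwa [neg_sq] at this
    have hCk : 0 ≤ C / (1 + ((k + 2 : ℝ) / 4) ^ 2) := by positivity
    calc ENNReal.ofReal (quarterCoeff (k + 2)) *
          (‖r ((k + 2 : ℝ) / 4)‖ₑ + ‖r (-((k + 2 : ℝ) / 4))‖ₑ)
        ≤ 1 * (ENNReal.ofReal (C / (1 + ((k + 2 : ℝ) / 4) ^ 2))
              + ENNReal.ofReal (C / (1 + ((k + 2 : ℝ) / 4) ^ 2))) := by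
          gcongr
      _ = ENNReal.ofReal (g k) := by
          rw [one_mul, ← ENNReal.ofReal_add hCk hCk, hg]
          congr 1; ring
  have hsum : Summable g := by
    have hbase : Summable fun k : ℕ => 32 * C * (1 / ((k + 2 : ℕ) : ℝ) ^ 2) := by
      have h2 : Summable fun n : ℕ => 1 / ((n : ℝ)) ^ 2 := Real.summable_one_div_nat_pow.mpr one_lt_two
      exact ((summable_nat_add_iff 2).mpr h2).mul_left (32 * C)
    refine Summable.of_nonneg_of_le hg0 (fun k => ?_) hbase
    have hk2 : (0 : ℝ) < ((k + 2 : ℕ) : ℝ) := by positivity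
    simp only [hg]
    push_cast
    rw [div_le_iff₀ (by positivity)]
    have : (1 : ℝ) / ((k : ℝ) + 2) ^ 2 * (1 + (((k : ℝ) + 2) / 4) ^ 2) ≥ 1 / 16 := by
      rw [ge_iff_le, show (1 : ℝ) / ((k : ℝ) + 2) ^ 2 * (1 + (((k : ℝ) + 2) / 4) ^ 2)
            = 1 / ((k : ℝ) + 2) ^ 2 + 1 / 16 by field_simp; ring]
      have : 0 ≤ (1 : ℝ) / ((k : ℝ) + 2) ^ 2 := by positivity
      linarith
    nlinarith
  calc ∑' k : ℕ, ENNReal.ofReal (quarterCoeff (k + 2)) *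
          (‖r ((k + 2 : ℝ) / 4)‖ₑ + ‖r (-((k + 2 : ℝ) / 4))‖ₑ)
      ≤ ∑' k : ℕ, ENNReal.ofReal (g k) := ENNReal.tsum_le_tsum hbound
    _ = ENNReal.ofReal (∑' k : ℕ, g k) := (ENNReal.ofReal_tsum_of_nonneg hg0 hsum).symm
    _ < ⊤ := ENNReal.ofReal_lt_top

/-- The density is at most `1`. -/
theorem quarterDensity_le_one (α : ℝ) : quarterDensity α ≤ 1 := by
  unfold quarterDensity
  split_ifs with h1 h2
  · exact zero_le_one
  · exact h2
  · exact quarterLevel_le_one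

/-- The atom weight `b = 2 − 2t` is non-negative. -/
theorem quarterAtom_nonneg : 0 ≤ quarterAtom := by
  unfold quarterAtom; linarith [quarterLevel_le_one]

/-- The atom weight is at most `1`. -/
theorem quarterAtom_le_one : quarterAtom ≤ 1 := by
  unfold quarterAtom; linarith [seven_tenths_le_quarterLevel]

/-- `Σ_{j∈ℤ} C/(1+j²) < ∞`. -/
theorem summable_const_div_one_add_sq_int (C : ℝ) :
    Summable fun j : ℤ => C / (1 + (j : ℝ) ^ 2) := by
  have hnat : Summable fun n : ℕ => C / (1 + (n : ℝ) ^ 2) := by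
    have h2 : Summable fun n : ℕ => 1 / ((n : ℝ)) ^ 2 := Real.summable_one_div_nat_pow.mpr one_lt_two
    have h3 : Summable fun n : ℕ => 2 * |C| * (1 / (((n + 1 : ℕ) : ℝ)) ^ 2) :=
      ((summable_nat_add_iff 1).mpr h2).mul_left (2 * |C|)
    refine Summable.of_norm_bounded h3 (fun n => ?_)
    rw [Real.norm_eq_abs, abs_div, abs_of_pos (by positivity : (0:ℝ) < 1 + (n:ℝ) ^ 2)]
    push_cast
    have hn1 : (0:ℝ) < ((n:ℝ) + 1) ^ 2 := by positivity
    have key : ((n:ℝ) + 1) ^ 2 ≤ 2 * (1 + (n:ℝ) ^ 2) := by nlinarith [sq_nonneg ((n:ℝ) - 1)]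
    have hfrac : 1 / (1 + (n:ℝ) ^ 2) ≤ 2 * (1 / ((n:ℝ) + 1) ^ 2) := by
      rw [div_le_iff₀ (by positivity),
        show 2 * (1 / ((n:ℝ) + 1) ^ 2) * (1 + (n:ℝ) ^ 2) = 2 * (1 + (n:ℝ) ^ 2) / ((n:ℝ) + 1) ^ 2 by ring,
        le_div_iff₀ hn1]
      linarith
    calc |C| / (1 + (n:ℝ) ^ 2) = |C| * (1 / (1 + (n:ℝ) ^ 2)) := by ring
      _ ≤ |C| * (2 * (1 / ((n:ℝ) + 1) ^ 2)) := by gcongr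
      _ = 2 * |C| * (1 / ((n:ℝ) + 1) ^ 2) := by ring
  refine Summable.of_nat_of_neg hnat ?_
  simpa using hnat

/-- A function with quadratic decay is integrable against a lattice of Dirac masses `Σ_j w_j δ_{a j}`
with weights `≤ 1` and `|a j| ≥ |j|`. -/
theorem hasFiniteIntegral_dirac_sum {R : ℝ → ℝ} {C : ℝ} (hC : ∀ α, |R α| ≤ C / (1 + α ^ 2))
    (w : ℤ → ENNReal) (hw : ∀ j, w j ≤ 1) (a : ℤ → ℝ) (ha : ∀ j : ℤ, |(j : ℝ)| ≤ |a j|) :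
    (∫⁻ α, ‖R α‖ₑ ∂(Measure.sum fun j : ℤ => w j • Measure.dirac (a j))) < ⊤ := by
  have hC0 : 0 ≤ C := by
    have := hC 0
    simp only [ne_eq, OfNat.ofNat_ne_zero, not_false_eq_true, zero_pow, add_zero, div_one] at this
    exact le_trans (abs_nonneg _) this
  rw [lintegral_sum_measure]
  have hterm : ∀ j : ℤ, ∫⁻ α, ‖R α‖ₑ ∂(w j • Measure.dirac (a j)) = w j * ‖R (a j)‖ₑ := by
    intro j; rw [lintegral_smul_measure, lintegral_dirac, smul_eq_mul]
  simp_rw [hterm]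
  set g : ℤ → ℝ := fun j => C / (1 + (j : ℝ) ^ 2) with hg
  have hg0 : ∀ j, 0 ≤ g j := fun j => by simp only [hg]; positivity
  have hbound : ∀ j : ℤ, w j * ‖R (a j)‖ₑ ≤ ENNReal.ofReal (g j) := by
    intro j
    have h1 : ‖R (a j)‖ₑ ≤ ENNReal.ofReal (C / (1 + (a j) ^ 2)) := by
      rw [Real.enorm_eq_ofReal_abs]; exact ENNReal.ofReal_le_ofReal (hC _)
    have h2 : C / (1 + (a j) ^ 2) ≤ g j := by
      simp only [hg]
      apply div_le_div_of_nonneg_left hC0 (by positivity)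
      have h := ha j
      have hsq : (j : ℝ) ^ 2 ≤ (a j) ^ 2 := by
        rw [← sq_abs (j : ℝ), ← sq_abs (a j)]
        exact pow_le_pow_left₀ (abs_nonneg _) h 2
      linarith
    calc w j * ‖R (a j)‖ₑ ≤ 1 * ENNReal.ofReal (C / (1 + (a j) ^ 2)) := by gcongr; exact hw j
      _ ≤ ENNReal.ofReal (g j) := by rw [one_mul]; exact ENNReal.ofReal_le_ofReal h2
  calc ∑' j : ℤ, w j * ‖R (a j)‖ₑ ≤ ∑' j : ℤ, ENNReal.ofReal (g j) := ENNReal.tsum_le_tsum hbound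
    _ = ENNReal.ofReal (∑' j : ℤ, g j) :=
        (ENNReal.ofReal_tsum_of_nonneg hg0 (summable_const_div_one_add_sq_int C)).symm
    _ < ⊤ := ENNReal.ofReal_lt_top

/-- A continuous function with quadratic decay is integrable against `quarterNu`. -/
theorem integrable_quarterNu {R : ℝ → ℝ} (hR : Continuous R)
    (hdecay : ∃ C : ℝ, ∀ α : ℝ, |R α| ≤ C / (1 + α ^ 2)) : Integrable R quarterNu := by
  obtain ⟨C, hC⟩ := hdecay
  have hC0 : 0 ≤ C := by
    have := hC 0
    simp only [ne_eq, OfNat.ofNat_ne_zero, not_false_eq_true, zero_pow, add_zero, div_one] at this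
    exact le_trans (abs_nonneg _) this
  -- Lebesgue integrability from the decay
  have hvol : Integrable R volume := by
    refine Integrable.mono' ((integrable_inv_one_add_sq).const_mul C) hR.aestronglyMeasurable ?_
    filter_upwards with α
    rw [Real.norm_eq_abs]
    simpa [div_eq_mul_inv] using hC α
  unfold quarterNu
  refine (hvol.mono_measure ?_).add_measure (Integrable.add_measure ?_ ?_)
  · -- density part ≤ Lebesgue
    calc volume.withDensity (fun α => ENNReal.ofReal (quarterDensity α))
        ≤ volume.withDensity 1 := by
          refine withDensity_mono (Filter.Eventually.of_forall fun α => ?_)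
          rw [Pi.one_apply, ← ENNReal.ofReal_one]
          exact ENNReal.ofReal_le_ofReal (quarterDensity_le_one α)
      _ = volume := withDensity_one
  · -- unit atoms at `4j`, `j ≠ 0`
    have hrw : (Measure.sum fun j : ℤ => if j = 0 then (0 : Measure ℝ) else Measure.dirac (4 * (j : ℝ)))
        = Measure.sum fun j : ℤ => (if j = 0 then (0:ENNReal) else 1) • Measure.dirac (4 * (j : ℝ)) := by
      congr 1; ext1 j; split_ifs <;> simp
    rw [hrw]
    refine ⟨hR.aestronglyMeasurable, ?_⟩
    refine hasFiniteIntegral_dirac_sum hC _ (fun j => ?_) _ (fun j => ?_)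
    · split_ifs <;> simp
    · rw [abs_mul, show |(4:ℝ)| = 4 by norm_num]
      linarith [abs_nonneg (j : ℝ)]
  · -- atoms `b` at `4j + 2`
    refine ⟨hR.aestronglyMeasurable, ?_⟩
    refine hasFiniteIntegral_dirac_sum hC _ (fun j => ?_) _ (fun j => ?_)
    · rw [← ENNReal.ofReal_one]; exact ENNReal.ofReal_le_ofReal quarterAtom_le_one
    · rcases le_or_gt 0 j with h | h
      · have h' : (0:ℝ) ≤ j := by exact_mod_cast h
        rw [abs_of_nonneg h', abs_of_nonneg (by linarith)]; linarith
      · have h' : (j:ℝ) ≤ -1 := by exact_mod_cast Int.le_sub_one_of_lt h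
        rw [abs_of_neg (by linarith), abs_of_neg (by linarith)]; linarith

/-- TAMENESS of the explicit AH¼ pair — PROVED. -/
theorem quarterTame : QuarterTame := by
  intro r lam hr
  have hcont := continuous_cosTransform hr.integrable
  exact ⟨integrable_quarterRho hr.continuous hr.decay, integrable_quarterNu hcont hr.transform_decay, hcont⟩

/-- The explicit pair is a (quadratic-decay) dual witness at height `t` on `(1,3)`, given `QuarterParseval`. -/
theorem quarter_isDualWitnessQD (hP : QuarterParseval) : IsDualWitnessQD quarterRho quarterNu quarterLevel 3 where
  core := quarterRho_core
  offDiag := quarterNu_offDiag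
  floor := quarterNu_floor
  parseval := hP

/-- ASSEMBLY of the construction statement from the two analytic inputs. -/
theorem quarterWitnessExistsQD_of (hP : QuarterParseval) : QuarterWitnessExistsQD :=
  ⟨quarterRho, quarterNu, quarter_isDualWitnessQD hP, quarterTame, rfl⟩

/-- Hence the height-wall lower edge from the Poisson identity ALONE. -/
theorem heightWallLowerEdge_of_parseval (hP : QuarterParseval) : HeightWallLowerEdge :=
  heightWallLowerEdge_ofQD (quarterWitnessExistsQD_of hP)

end Summit.Parity.GeneralizedHardyLittlewood.Theorems.PrimeLevelFamEdgeIdeaDeltas.FloorDual
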